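import Summits.BirchSwinnertonDyer.Rank1Residual.X2.GreenbergVatsalSelmerLink
import Summits.BirchSwinnertonDyer.Rank1Residual.AdditivePotMult.PrimeToPDescent
import Literature.NumberTheory.GaloisRepresentations.LocalGaloisGroupProofs
import Literature.NumberTheory.EllipticCurves.H1CorestrictionIndexTwo
import HarnessLib

/-!
# Greenberg's inertia condition IS the strict condition when the quotient `M/M⁺_v` has no
# non-zero invariants under the inertia group `H ⊓ I_v` (cell `b2b-bsdres`, team n1011, row
# T-RD-Δ-K, kernel half of r2's ROUTE-2 §II.15.3 ARM δ; lead R5-40 (b); seat n1011-p05 gen 3;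
# cc-typer-2's transport item T2 at the bottom level)

HONEST FRAMING (cell `b2b-bsdres`, run/shared/lean/b2b/bsd-rank1-residual/, verbatim in every
file): the goal of the cell is to DELETE the COMBINATION-SHAPED residual classes of the
Birch–Swinnerton-Dyer formula for ALL analytic-rank `≤ 1` elliptic curves over `ℚ` — "full BSD
formula for every rank `≤ 1` curve in class `C`" assembled STRICTLY from published theorems — so
that the rank-`≤ 1` remainder becomes exactly the CONSTRUCTION-SHAPED classes, which are TYPED
(missing-input `Prop`s), NOT attempted. This is not "finishing BSD". Team n1011 (X4 ∧ `p = 3`,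
§I N10/N11; ROUTE-2 of planner r2): research route; TOOL theorems of Galois cohomology only; no
definition, no named fact; nothing booked; no label changes.

## What and why

Greenberg's local condition at `v ∣ p` for an ordinary datum `N = (M⁺_v ≤ M)` over `L = K̄^H`
comes in two printed forms: the INERTIA form `ker (H¹(H, M) → H¹(H ⊓ I_v, M/M⁺_v))`
(Greenberg 1989 (4), Greenberg–Vatsal 2000 p. 16; the tree's `LocalDatum.greenbergKer`) and the
STRICT form with the decomposition group `H ⊓ D_v` (Greenberg 1989 p. 98; Greenberg 1999
Prop. 2.4 `Im λ`; the tree's `LocalDatum.strictKer`, the currency of cc-typer-2's typed fact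
`Greenberg1999.imKummer_ge_strictCondition_goodOrdinary`, p262636). `strictKer ≤ greenbergKer` is
the tree's tautology `LocalDatum.strictKer_le_greenbergKer`. The converse is inflation–restriction:
`H¹((H ⊓ D_v)/(H ⊓ I_v), (M/M⁺_v)^{H ⊓ I_v}) = 0`. The X2 lineage proved it over `ℚ_∞` at a good
ordinary `p`, where `(M/M⁺_v)^{I} = Ẽ[p^∞]` is everything and `Frob − 1` is onto
(`GreenbergVatsalStrictAtP.greenbergKer_le_strictKer`). This file is the OTHER, elementary case
needed by ARM δ at the bottom level `ℚ_∞` for the datum of the ADDITIVE curve `E = V ⊗ χ`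
(cc-typer-2, INBOX 2026-08-21T10:58Z, "ALTERNATIVE"): there `H ⊓ I_v` acts on
`M/M⁺_v = Ẽ_V[p^∞] ⊗ χ` through the non-trivial tame character `χ`, so **`(M/M⁺_v)^{H ⊓ I_v} = 0`
and the two conditions coincide by two lines of cocycle algebra** — no Frobenius, no surjectivity:

* `conj_mem_inertia_of_mem_decomp` — `I_v` is normalised by `D_v` inside `Γ_K`;
* **`greenbergKer_le_strictKer_of_forall_fixed_eq_zero`** — for ANY number field `K`, discrete
  `Γ_K`-module `M`, `H ≤ Γ_K`, datum `N` at `v`: if `d = 0` is the only element of `M/M⁺_v` fixed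
  by `H ⊓ I_v`, then `N.greenbergKer H ≤ N.strictKer H`; `greenbergKer_eq_strictKer_of_forall_fixed_eq_zero`;
* `forall_fixed_eq_zero_of_smul_eq_neg` — the sufficient condition used by the quadratic-twist
  rows: `M/M⁺_v` `p`-primary with `p ≠ 2` and some `σ ∈ H ⊓ I_v` acting as `−1`.

Proof of the main lemma: for a cocycle `g` of `H ⊓ D_v` with values in `D = M/M⁺_v` and `q ∈ D`
with `g(i) = i•q − q` on `H ⊓ I_v`, put `e(y) = g(y) − (y•q − q)`; expanding `g(i·y) = g(y·(y⁻¹iy))`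
with the cocycle identity gives `i • e(y) = e(y)` for every inertial `i`, hence `e(y) = 0`.

References: [Greenberg1989] §1 p. 98 ((4), "strict"); [GreenbergLNM1716] §2 pp. 73–75;
[SerreGaloisCohomology1997] I.§2.6 (b) (inflation–restriction).
-/

noncomputable section

open scoped Classical

universe u

namespace Summit.BirchSwinnertonDyer.Rank1Residual.GaloisImage

open NumberField IsDedekindDomain Field Literature.NumberTheory.GaloisRepresentations
  Literature.NumberTheory.EllipticCurves Literature.NumberTheory.EllipticCurves.GreenbergSelmer
  Summit.BirchSwinnertonDyer.Rank1Residual.AdditivePotMult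

variable {K : Type u} [Field K] [NumberField K]

/-! ## §1 `I_v` is normal in `D_v` -/

/-- `I_v ⊴ D_v` inside `Γ_K`: for `g ∈ D_v` and `i ∈ I_v`, `g i g⁻¹ ∈ I_v` (the absolute inertia
group of `K_v` is normal in `Γ_{K_v}`, tree `absInertia_normal_holds`).
[cite: NeukirchANT1999, Ch. I §9 (9.5)] -/
theorem conj_mem_inertia_of_mem_decomp (v : HeightOneSpectrum (𝓞 K)) {g i : absoluteGaloisGroup K}
    (hg : g ∈ decomp v) (hi : i ∈ inertia v) : g * i * g⁻¹ ∈ inertia v := by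
  obtain ⟨σ, rfl⟩ := (mem_decomp_iff v g).1 hg
  obtain ⟨ι, hι, rfl⟩ := Subgroup.mem_map.1 hi
  haveI : (absInertia (v.adicCompletion K)).Normal := absInertia_normal_holds (v.adicCompletion K)
  refine Subgroup.mem_map.2 ⟨σ * ι * σ⁻¹, Subgroup.Normal.conj_mem inferInstance ι hι σ, ?_⟩
  simp only [map_mul, map_inv]
  rfl

/-! ## §2 Greenberg's condition implies the strict condition when `(M/M⁺_v)^{H ⊓ I_v} = 0` -/

section Main

variable (H : Subgroup (absoluteGaloisGroup K)) {M : Type u} [AddCommGroup M]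
  [DistribMulAction (absoluteGaloisGroup K) M] [TopologicalSpace M] [DiscreteTopology M]
  {v : HeightOneSpectrum (𝓞 K)} (N : LocalDatum K M v)

/-- **Inflation–restriction, degenerate case.** If the only element of `M/M⁺_v` fixed by the
inertia group `H ⊓ I_v` is `0`, then every class of `H¹(H, M)` whose image dies in
`H¹(H ⊓ I_v, M/M⁺_v)` (Greenberg's condition) already dies in `H¹(H ⊓ D_v, M/M⁺_v)` (the strict
condition): `N.greenbergKer H ≤ N.strictKer H`. [cite: SerreGaloisCohomology1997, I.§2.6 (b)]
[cite: Greenberg1989, §1 p. 98] -/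
theorem greenbergKer_le_strictKer_of_forall_fixed_eq_zero
    (hD : ∀ d : N.Gr, (∀ x : inertiaIn H v, x • d = d) → d = 0) :
    N.greenbergKer H ≤ N.strictKer H := by
  intro c hc
  obtain ⟨f, rfl⟩ := oneCocycleClass_surjective (discreteTopRep H M) c
  obtain ⟨q, hq⟩ :=
    (X2.GreenbergVatsalSelmerLink.oneCocycleClass_mem_greenbergKer_iff H M N f).1 hc
  rw [LocalDatum.mem_strictKer_iff, LocalDatum.strictMap, resH1Hom_oneCocycleClass,
    oneCocycleClass_eq_zero_iff]
  set g := contOneCocycles.pullback (decompInToH H v)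
    (resHomOfEquivariant _ N.grMk fun _ _ ↦ rfl) f with hg
  -- `g` is principal (with the same `q`) on the inertial elements of `H ⊓ D_v`
  have hgI : ∀ y : decompIn H v, ((y : decomp (K := K) v) : absoluteGaloisGroup K) ∈ inertia v →
      g.1 y = y • q - q := fun y hyI ↦ by
    have hyH : ((y : decomp (K := K) v) : absoluteGaloisGroup K) ∈ H := (mem_decompIn_iff H v _).1 y.2
    set y' : inertiaIn H v := ⟨(y : decomp (K := K) v), (mem_inertiaIn_iff H v _).2 ⟨hyH, hyI⟩⟩
      with hy'
    have e1 : inertiaInToH H v y' = decompInToH H v y := Subtype.ext rfl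
    have h := hq y'
    rw [e1] at h
    rw [hg, contOneCocycles.pullback_apply]
    exact h
  refine ⟨q, fun y ↦ ?_⟩
  -- `e := g y - (y • q - q)` is fixed by every inertial element, hence `0`
  have key : ∀ x : inertiaIn H v, x • (g.1 y - (y • q - q)) = g.1 y - (y • q - q) := by
    intro x
    have hxI : ((x : decomp (K := K) v) : absoluteGaloisGroup K) ∈ inertia v :=
      ((mem_inertiaIn_iff H v _).1 x.2).2
    have hxH : ((x : decomp (K := K) v) : absoluteGaloisGroup K) ∈ H :=
      ((mem_inertiaIn_iff H v _).1 x.2).1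
    set i : decompIn H v := ⟨(x : decomp (K := K) v), (mem_decompIn_iff H v _).2 hxH⟩ with hi
    -- the conjugate `j = y⁻¹ i y` is inertial and `i * y = y * j`
    set j : decompIn H v := y⁻¹ * i * y with hj
    have hjI : ((j : decomp (K := K) v) : absoluteGaloisGroup K) ∈ inertia v := by
      have h := conj_mem_inertia_of_mem_decomp v (g := ((y⁻¹ : decompIn H v) : decomp (K := K) v))
        (i := ((i : decomp (K := K) v) : absoluteGaloisGroup K)) (Subtype.coe_prop _) hxI
      simpa [hj, mul_assoc] using h
    have hiy : i * y = y * j := by rw [hj]; group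
    have h1 : g.1 (i * y) = g.1 i + i • g.1 y := cocycle_mul' g i y
    have h2 : g.1 (y * j) = g.1 y + y • g.1 j := cocycle_mul' g y j
    rw [hgI i hxI] at h1
    rw [hgI j hjI, smul_sub, ← mul_smul, ← hiy, mul_smul] at h2
    have h3 : i • q - q + i • g.1 y = g.1 y + (i • y • q - y • q) := h1.symm.trans h2
    have hx : ∀ d : N.Gr, x • d = i • d := fun _ ↦ rfl
    rw [hx, smul_sub, smul_sub]
    -- linear algebra in the abelian group `N.Gr`
    have h4 : i • g.1 y = g.1 y + (i • y • q - y • q) - (i • q - q) := by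
      rw [← h3]; abel
    rw [h4]; abel
  have hzero := hD _ key
  exact sub_eq_zero.mp hzero

/-- **Equality of the two local conditions** under the same hypothesis.
[cite: Greenberg1989, §1 p. 98] -/
theorem greenbergKer_eq_strictKer_of_forall_fixed_eq_zero
    (hD : ∀ d : N.Gr, (∀ x : inertiaIn H v, x • d = d) → d = 0) :
    N.greenbergKer H = N.strictKer H :=
  le_antisymm (greenbergKer_le_strictKer_of_forall_fixed_eq_zero H N hD)
    (N.strictKer_le_greenbergKer H)

omit [TopologicalSpace M] [DiscreteTopology M] in
/-- **The quadratic-twist sufficient condition.** If `M/M⁺_v` is `p`-primary with `p ≠ 2` and some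
element of `H ⊓ I_v` acts on it as `−1` (the inertia of `ℚ_∞` acting on `Ẽ_V[p^∞] ⊗ χ_c` through the
ramified quadratic character `χ_c`), then `M/M⁺_v` has no non-zero `H ⊓ I_v`-invariants.
[cite: GreenbergLNM1716, §2 p. 73] -/
theorem forall_fixed_eq_zero_of_smul_eq_neg {p : ℕ} [Fact p.Prime] (hp : p ≠ 2)
    (hGr : ∀ d : N.Gr, ∃ k : ℕ, p ^ k • d = 0) (σ : inertiaIn H v) (hσ : ∀ d : N.Gr, σ • d = -d) :
    ∀ d : N.Gr, (∀ x : inertiaIn H v, x • d = d) → d = 0 := by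
  intro d hd
  have h2 : 2 • d = 0 := by
    have h := hd σ
    rw [hσ] at h
    rw [two_nsmul]
    nth_rewrite 1 [← h]
    exact neg_add_cancel d
  have hcop : (2 : ℕ).Coprime p :=
    (Nat.coprime_primes Nat.prime_two (Fact.out : p.Prime)).2 (Ne.symm hp)
  exact eq_zero_of_nsmul_eq_zero_of_coprime hGr hcop h2

/-- **Greenberg's condition = strict condition for a datum on which an inertial element acts as
`−1` on the quotient** (`p ≠ 2`). [cite: Greenberg1989, §1 p. 98] -/
theorem greenbergKer_eq_strictKer_of_smul_eq_neg {p : ℕ} [Fact p.Prime] (hp : p ≠ 2)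
    (hGr : ∀ d : N.Gr, ∃ k : ℕ, p ^ k • d = 0) (σ : inertiaIn H v) (hσ : ∀ d : N.Gr, σ • d = -d) :
    N.greenbergKer H = N.strictKer H :=
  greenbergKer_eq_strictKer_of_forall_fixed_eq_zero H N
    (forall_fixed_eq_zero_of_smul_eq_neg H N hp hGr σ hσ)

end Main

end Summit.BirchSwinnertonDyer.Rank1Residual.GaloisImage

end
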